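import Summits.Ventures.HSemireg.WedgeHankelRecurrenceGaussChebyshevConvexity
import Mathlib.Algebra.Polynomial.Taylor

/-!
# Venture HSemireg — **ALL DERIVATIVES OF `T_n, U_n` AT `1` AND OF `C_n, S_n` AT `2` IN CLOSED BINOMIAL FORM, IN EVERY COMMUTATIVE RING: `U_n^{(k)}(1) = k!·2^k·C(n+1+k, 2k+1)`,
# `2T_{n+1}^{(k)}(1) = k!·2^k·(C(n+1+k, 2k) + C(n+k, 2k))`, `S_n^{(k)}(2) = k!·C(n+1+k, 2k+1)`, `C_{n+1}^{(k)}(2) = k!·(C(n+1+k, 2k) + C(n+k, 2k))`**, and the Taylor coefficients at `1`: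
# `(U_n(X+1))_k = 2^k C(n+1+k, 2k+1)`, `2(T_{n+1}(X+1))_k = 2^k (C(n+1+k, 2k) + C(n+k, 2k))` (Rivlin's (1.97)–(1.98) in binomial normal form; from N549 through `U_n = S_n(2X)`, `2T_n = C_n(2X)` and
# `p^{(k)}(r) = k!·(p(X + r))_k`)

HONEST FRAMING. Part of the Lean index of the computation cell `pub-hsemireg` (seat p10 gen 49, Sunday typer «UNIFORM-IN-n»).  Polynomial algebra with the formal derivative (Mathlib `Polynomial.derivative`,
`hasseDeriv`, `taylor`, `Polynomial.Chebyshev.T ∕ U ∕ C ∕ S`); no variety, no cohomology theory, no sheaf, no Ext group and no semiregularity map is constructed here; nothing here says that HC / HC_CM / HC_AV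
holds; no Literature fact (unproved `Prop`) is declared or used.  Custodian versions as in `WedgeHankelSiegelIdeal` (1/3).
SOURCES (cited).  T. J. Rivlin, *The Chebyshev Polynomials* (Wiley 1974), §1.5, (1.97) `T_n^{(k)}(1) = ∏_{j<k}(n² − j²)∕(2j+1)`, (1.98) (the `U_n` companion); NIST DLMF 18.9.21, 18.7; J. C. Mason, D. C. Handscomb,
*Chebyshev Polynomials* (2003), §2.4.5.
PROOF TYPED HERE.  `k!·hasseDeriv k = derivative^[k]` (Mathlib `factorial_smul_hasseDeriv`) and `(taylor r p)_k = (hasseDeriv k p)(r)` (`taylor_coeff`, `taylor_apply`) give `p^{(k)}(r) = k!·(p(X + r))_k`;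
`(p(2X))_k = 2^k p_k` (`comp_C_mul_X_coeff`); `U_n(X+1) = S_n(X+2)(2X)`, `2T_n(X+1) = C_n(X+2)(2X)` (`S_comp_two_mul_X`, `C_comp_two_mul_X`, `comp_assoc`); then N549
`chebyshevS_comp_X_add_two_coeff ∕ chebyshevC_comp_X_add_two_coeff`.
DEDUP DISCLOSURE (`rg -n 'iterate_derivative|hasseDeriv|taylor' Summits/Ventures/HSemireg Literature/Algebra/Polynomial Literature/Analysis/Approximation`, 2026-09-05): Mathlib has the PRODUCT forms
`Polynomial.Chebyshev.iterate_derivative_T_eval_one` (`(∏_{l<k}(2l+1))·T_n^{(k)}(1) = ∏_{l<k}(n² − l²)`), `iterate_derivative_U_eval_one` (`(∏_{l<k}(2l+3))·U_n^{(k)}(1) = (∏_{l<k}((n+1)² − (l+1)²))·(n+1)`),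
their `_eq_div ∕ _dvd` versions and the recurrences `iterate_derivative_T ∕ U_eval_one_recurrence` (cited — a different normal form: products with an odd-factorial factor on the left, valid for `n ∈ ℤ`;
the binomial closed forms below are for `n ∈ ℕ` and carry no left factor); `Literature…ChebyshevSubmultiplicative.abs_iterate_derivative_T_le` and N444 `…GaussChebyshevMarkovBound` BOUND derivatives by
their value at `1` without evaluating it; no binomial closed form and no Taylor coefficient at `1` in Mathlib or the tree; 0 hits for the 8 names below.

WHAT IS IN THE TREE.  N549 `chebyshevS_comp_X_add_two_coeff`, `chebyshevC_comp_X_add_two_coeff`; Mathlib `factorial_smul_hasseDeriv`, `taylor_coeff`, `taylor_apply`, `eval_smul`, `comp_C_mul_X_coeff`,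
`S_comp_two_mul_X`, `C_comp_two_mul_X`, `comp_assoc`, `coeff_ofNat_mul`.
THIS FILE (namespace `Summit.Ventures.HSemireg.Wedge.HankelOuter` continued; CHAINED on N550; 0 definitions):
* §1316 `coeff_comp_two_mul_X` (`(p(2X))_k = 2^k p_k`), `iterate_derivative_eval_eq_factorial_mul_coeff` (`p^{(k)}(r) = k!·(p(X+r))_k`), **`chebyshevU_comp_X_add_one_coeff`**,
  **`two_mul_chebyshevT_comp_X_add_one_coeff`**, **`iterate_derivative_chebyshevS_eval_two`**, **`iterate_derivative_chebyshevC_eval_two`**, **`iterate_derivative_chebyshevU_eval_one_eq_choose`**,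
  **`two_mul_iterate_derivative_chebyshevT_eval_one_eq_choose`** (statements as in the title).
CAVEATS.  `n, k ∈ ℕ`; the `T ∕ C` statements are indexed `n + 1` and keep the factor `2` on the left (no division by `2` in a general ring).  Nothing Ext-side.  New names only.
-/

open Module Polynomial
open scoped Matrix Polynomial Nat

namespace Summit.Ventures.HSemireg.Wedge.HankelOuter

/-! ## §1316. Derivatives at the endpoint in binomial form -/

/-- `(p(2X))_k = 2^k·p_k` (Mathlib `comp_C_mul_X_coeff`). [this file, §1316] -/
theorem coeff_comp_two_mul_X {R : Type*} [CommRing R] (p : R[X]) (k : ℕ) : (p.comp (2 * X)).coeff k = 2 ^ k * p.coeff k := by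
  rw [show (2 : R[X]) * X = Polynomial.C 2 * X by rw [map_ofNat], comp_C_mul_X_coeff, mul_comm]

/-- **`p^{(k)}(r) = k!·(p(X + r))_k`** in every commutative ring (Taylor's formula read through the Hasse derivative: `k!·D^{[k]} = D^k`). [this file, §1316] -/
theorem iterate_derivative_eval_eq_factorial_mul_coeff {R : Type*} [CommRing R] (p : R[X]) (r : R) (k : ℕ) :
    (derivative^[k] p).eval r = (k ! : R) * (p.comp (X + Polynomial.C r)).coeff k := by
  have h := congrFun (Polynomial.factorial_smul_hasseDeriv (R := R) k) p
  rw [← h, LinearMap.smul_apply, eval_smul, nsmul_eq_mul, ← taylor_coeff, taylor_apply]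

/-- **`(U_n(X+1))_k = 2^k·C(n+1+k, 2k+1)`** in every commutative ring (`U_n(X+1) = S_n(X+2)∘(2X)`). [Rivlin 1974, (1.98) (equivalent); this file, §1316] -/
theorem chebyshevU_comp_X_add_one_coeff {R : Type*} [CommRing R] (n k : ℕ) :
    ((Polynomial.Chebyshev.U R (n : ℤ)).comp (X + 1)).coeff k = 2 ^ k * ((n + 1 + k).choose (2 * k + 1) : R) := by
  have e : ((2 : R[X]) * X).comp (X + 1) = (X + 2).comp (2 * X) := by
    simp only [mul_comp, add_comp, X_comp, ofNat_comp]
    ring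
  rw [← Polynomial.Chebyshev.S_comp_two_mul_X, comp_assoc, e, ← comp_assoc, coeff_comp_two_mul_X, chebyshevS_comp_X_add_two_coeff]

/-- **`2·(T_{n+1}(X+1))_k = 2^k·(C(n+1+k, 2k) + C(n+k, 2k))`** in every commutative ring (`2T_n(X+1) = C_n(X+2)∘(2X)`). [Rivlin 1974, (1.97) (equivalent); this file, §1316] -/
theorem two_mul_chebyshevT_comp_X_add_one_coeff {R : Type*} [CommRing R] (n k : ℕ) :
    2 * ((Polynomial.Chebyshev.T R ((n + 1 : ℕ) : ℤ)).comp (X + 1)).coeff k = 2 ^ k * ((n + 1 + k).choose (2 * k) + (n + k).choose (2 * k) : R) := by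
  have e : ((2 : R[X]) * X).comp (X + 1) = (X + 2).comp (2 * X) := by
    simp only [mul_comp, add_comp, X_comp, ofNat_comp]
    ring
  have h2 : (2 * Polynomial.Chebyshev.T R ((n + 1 : ℕ) : ℤ)).comp (X + 1) = 2 * (Polynomial.Chebyshev.T R ((n + 1 : ℕ) : ℤ)).comp (X + 1) := by
    rw [show (2 : R[X]) * Polynomial.Chebyshev.T R ((n + 1 : ℕ) : ℤ) = Polynomial.C 2 * Polynomial.Chebyshev.T R ((n + 1 : ℕ) : ℤ) by rw [map_ofNat], mul_comp, C_comp, map_ofNat]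
  rw [← coeff_ofNat_mul, ← h2, ← Polynomial.Chebyshev.C_comp_two_mul_X, comp_assoc, e, ← comp_assoc, coeff_comp_two_mul_X, chebyshevC_comp_X_add_two_coeff]

/-- **`S_n^{(k)}(2) = k!·C(n+1+k, 2k+1)`** in every commutative ring. [this file, §1316] -/
theorem iterate_derivative_chebyshevS_eval_two {R : Type*} [CommRing R] (n k : ℕ) :
    (derivative^[k] (Polynomial.Chebyshev.S R (n : ℤ))).eval 2 = ((k ! * (n + 1 + k).choose (2 * k + 1) : ℕ) : R) := by
  rw [iterate_derivative_eval_eq_factorial_mul_coeff, map_ofNat, chebyshevS_comp_X_add_two_coeff, Nat.cast_mul]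

/-- **`C_{n+1}^{(k)}(2) = k!·(C(n+1+k, 2k) + C(n+k, 2k))`** in every commutative ring. [this file, §1316] -/
theorem iterate_derivative_chebyshevC_eval_two {R : Type*} [CommRing R] (n k : ℕ) :
    (derivative^[k] (Polynomial.Chebyshev.C R ((n + 1 : ℕ) : ℤ))).eval 2 = ((k ! * ((n + 1 + k).choose (2 * k) + (n + k).choose (2 * k)) : ℕ) : R) := by
  rw [iterate_derivative_eval_eq_factorial_mul_coeff, map_ofNat, chebyshevC_comp_X_add_two_coeff]
  push_cast
  ring

/-- **`U_n^{(k)}(1) = k!·2^k·C(n+1+k, 2k+1)`** in every commutative ring (Rivlin's (1.98) in binomial form; Mathlib's `iterate_derivative_U_eval_one` is the product form). [Rivlin 1974, (1.98); this file, §1316] -/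
theorem iterate_derivative_chebyshevU_eval_one_eq_choose {R : Type*} [CommRing R] (n k : ℕ) :
    (derivative^[k] (Polynomial.Chebyshev.U R (n : ℤ))).eval 1 = ((k ! * 2 ^ k * (n + 1 + k).choose (2 * k + 1) : ℕ) : R) := by
  rw [iterate_derivative_eval_eq_factorial_mul_coeff, map_one, chebyshevU_comp_X_add_one_coeff]
  push_cast
  ring

/-- **`2·T_{n+1}^{(k)}(1) = k!·2^k·(C(n+1+k, 2k) + C(n+k, 2k))`** in every commutative ring (Rivlin's (1.97) in binomial form; Mathlib's `iterate_derivative_T_eval_one` is the product form).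
[Rivlin 1974, (1.97); this file, §1316] -/
theorem two_mul_iterate_derivative_chebyshevT_eval_one_eq_choose {R : Type*} [CommRing R] (n k : ℕ) :
    2 * (derivative^[k] (Polynomial.Chebyshev.T R ((n + 1 : ℕ) : ℤ))).eval 1 = ((k ! * 2 ^ k * ((n + 1 + k).choose (2 * k) + (n + k).choose (2 * k)) : ℕ) : R) := by
  rw [iterate_derivative_eval_eq_factorial_mul_coeff, map_one, mul_left_comm, two_mul_chebyshevT_comp_X_add_one_coeff]
  push_cast
  ring

end Summit.Ventures.HSemireg.Wedge.HankelOuter
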